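import Literature.NumberTheory.Automorphic.ArchTorusOrbitalFubiniSmooth         -- ★ p840553 (V7)-smooth: §1 properness of `G_w ↪ M_N(ℂ)`, §2 insertion matrix, public pi helpers; Hörmander ★, cutoff ★
import HarnessLib

/-!
# Mixed partial orbital TEST FUNCTIONS: integrating an ambient test function of `G′_∞ = Π_w G_w` against ARBITRARY Radon measures at the places `w′ ≠ w₀`
# leaves a smooth compactly supported test function on `G_{w₀}` ((R1-a) of R1 «(L-use) at all indefinite places»; Hörmander Thm. 1.1.9, Rogawski 1990 §8.2–8.3)

Topic `NumberTheory/Automorphic`; namespace `Literature.NumberTheory.Automorphic.UnitaryGroup`.  THEOREMS ONLY (no `def`, no instance, no notation, no axiom, no `sorry`).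
Cell `pub/hodgecm-mathlib`, ENGINE T1 (crux H413 = `stmt-HodgeConjecture-24833`); floor-2 road «(J-nc) in-house», brick (R1-a) of R1 `stub_LuseAllPlaces` (LEAD F0P3a-plan (g9) WORDS
T8-53 ∕ T8-57; census `CENSUS-R1-LuseAllPlaces` 8d436054; author F0P3a-p07 (g7), 2026-09-01).

WHY (the ORBIT-MEASURE currency of R1).  ★ (V7)-smooth `contDiff_partialOrbital` ∕ `exists_contDiff_partialOrbital_eq` (p840553) integrate `Θ(ins(X, (b_{w′}·diag(z_{w′})·b_{w′}⁻¹)_{w′}))`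
over the CONJUGATORS `b ∈ Π_{w′≠w₀} G_{w′}` against Haar measures — which needs `z_{w′}` REGULAR (properness of the orbit maps).  Along R1's induction the places already taken to the wall
carry SINGULAR orbits (noncompact centralisers): the right variables are the ORBIT POINTS `o_{w′} ∈ G_{w′}` themselves, integrated against ARBITRARY Radon measures `μ_{w′}` (orbit
measures: Haar push-forwards at regular points ∕ compact walls, quotient-measure push-forwards at noncompact walls).  In this currency compact support and smoothness of
`X ↦ ∫ Θ(ins(X, (↑↑o_{w′})_{w′})) d(⊗ μ_{w′})` need NOTHING about the measures beyond finiteness on compacts: the `o`-support of the integrand is the compact box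
`Π_{w′} coe⁻¹ π_{w′}(tsupport Θ)` (★ properness of `G_w ↪ M_N(ℂ)`).

WHAT IS PROVED (★ (V7)-smooth §3–§4 VERBATIM with `b_{w′}·diag(z_{w′})·b_{w′}⁻¹ ↦ o_{w′}` and `⊗ ν_{w′} ↦ ⊗ μ_{w′}`; no regularity hypothesis anywhere).
* `contDiff_integral_insert` — `X ↦ ∫ Θ(ins(X, (↑↑o_{w′}))) d(⊗ μ_{w′})` is `C^∞` on `M_N(ℂ)` for `Θ` ambient-smooth with compact ambient support and `μ_{w′}` finite on compacts (σ-finite).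
* `hasCompactSupport_integral_insert_comp_coe` — its restriction to `G_{w₀}` has compact support (any measures).
* `exists_contDiff_eq_integral_insert` — THE LETTER FORM: for `Θ` smooth with compact support ON THE GROUP `G′_∞` there is `Θ′ : M_N(ℂ) → E`, `ContDiff ℝ ⊤`, compact support on
  `G_{w₀}`, with `Θ′ ↑↑x′ = ∫ Θ ↑↑(e⁻¹(x′, o)) d(⊗ μ_{w′})(o)` — the binder shape of J1 ∕ (C-cw) ∕ (J-nc) ∕ ★ (δ).
HONEST LABEL: HC_CM is proved only modulo the 7 printed citations until rung 0 closes; this file is real analysis over Mathlib and pays nothing by itself.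

## References
* [HormanderALPDO1] L. Hörmander, *The Analysis of Linear Partial Differential Operators I*, 2nd ed. (1990), Thm. 1.1.9, Thm. 1.4.1.
* [Rogawski1990] J. D. Rogawski, *Automorphic Representations of Unitary Groups in Three Variables*, Ann. of Math. Stud. 123 (1990), §8.2 p. 122–124, §8.3 p. 122.
* [DeitmarEchterhoff2014] A. Deitmar, S. Echterhoff, *Principles of Harmonic Analysis*, 2nd ed. (2014), Lemma 9.3.3, Thm. 1.5.3.
* [BorelJacquet1979] A. Borel, H. Jacquet, *Automorphic forms and automorphic representations*, PSPM 33.1 (1979), §4.1.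
-/

set_option autoImplicit false

noncomputable section

open MeasureTheory Matrix NumberField NumberField.InfinitePlace NumberField.mixedEmbedding Set Function Topology
open scoped MatrixGroups ContDiff

namespace Literature.NumberTheory.Automorphic.UnitaryGroup

variable (L : Type) [Field L] [NumberField L] [IsCMField L] (N : ℕ) (α : Fin N → L)
  [∀ w : {w : InfinitePlace L // IsComplex w}, MeasurableSpace (archLocal L N (Matrix.diagonal α) w)]

-- the scoped `L^∞`-operator norm on `M_N(ℂ)` and `M_N(L ⊗ ℝ)`, the cell's ambient-smooth convention (★ `ArchimedeanCalculus`, ★ (V7)-smooth)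
open scoped Matrix.Norms.Operator

variable [∀ w : {w : InfinitePlace L // IsComplex w}, BorelSpace (archLocal L N (Matrix.diagonal α) w)]
  [∀ w : {w : InfinitePlace L // IsComplex w}, SecondCountableTopology (archLocal L N (Matrix.diagonal α) w)]

/-! ## §1 Smoothness and compact support of the mixed partial integral -/

omit [IsCMField L] in
open scoped Classical in
/-- **MIXED PARTIAL TEST FUNCTIONS ARE SMOOTH**: for `Θ : M_N(L ⊗ ℝ) → E` smooth with compact ambient support and ANY measures `μ_{w′}` on `G_{w′}` (`w′ ≠ w₀`) finite on
compacts, `X ↦ ∫ Θ(ins(X, (↑↑o_{w′})_{w′})) d(⊗_{w′} μ_{w′})(o)` is `C^∞` on `M_N(ℂ)` (the integrand is `Θ(Λ X + c(o))`, `‖Dⁿ_X‖ ≤ sup‖DⁿΘ‖·‖Λ‖ⁿ·𝟙_S(o)` with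
`S = Π_{w′} coe⁻¹ π_{w′}(tsupport Θ)` compact by ★ `isCompact_setOf_coe_archLocal_mem`; Hörmander Thm. 1.1.9 ★ `contDiff_integral_of_dominated_iteratedFDeriv`).
[cite: HormanderALPDO1, Thm. 1.1.9] [cite: Rogawski1990, §8.3 p. 122] [cite: DeitmarEchterhoff2014, Lemma 9.3.3] -/
theorem contDiff_integral_insert {E : Type*} [NormedAddCommGroup E] [NormedSpace ℝ E] [CompleteSpace E]
    (hα : ∀ i, α i ≠ 0) (w₀ : {w : InfinitePlace L // IsComplex w})
    (μ : ∀ w' : {w : {w : InfinitePlace L // IsComplex w} // ¬ w = w₀}, Measure (archLocal L N (Matrix.diagonal α) w'.1)) [∀ w', IsFiniteMeasureOnCompacts (μ w')] [∀ w', SigmaFinite (μ w')]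
    (Θ : Matrix (Fin N) (Fin N) (mixedSpace L) → E) (hΘ : ContDiff ℝ (⊤ : ℕ∞) Θ) (hΘc : HasCompactSupport Θ) :
    ContDiff ℝ (⊤ : ℕ∞) fun X : Matrix (Fin N) (Fin N) ℂ =>
      ∫ o : (∀ w' : {w : {w : InfinitePlace L // IsComplex w} // ¬ w = w₀}, archLocal L N (Matrix.diagonal α) w'.1),
        Θ (Matrix.of fun i j => ((0 : {w : InfinitePlace L // IsReal w} → ℝ), fun w : {w : InfinitePlace L // IsComplex w} =>
          if h : w = w₀ then X i j
          else (((o ⟨w, h⟩ : archLocal L N (Matrix.diagonal α) w) : GL (Fin N) ℂ) : Matrix (Fin N) (Fin N) ℂ) i j))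
        ∂(Measure.pi μ) := by
  -- the affine decomposition `ins(X, b) = Λ X + c b`
  set ℓ : ℂ →ₗ[ℝ] mixedSpace L :=
    (LinearMap.inr ℝ ({w : InfinitePlace L // IsReal w} → ℝ) ({w : InfinitePlace L // IsComplex w} → ℂ)).comp
      (LinearMap.single ℝ (fun _ : {w : InfinitePlace L // IsComplex w} => ℂ) w₀) with hℓ
  set Λ : Matrix (Fin N) (Fin N) ℂ →L[ℝ] Matrix (Fin N) (Fin N) (mixedSpace L) := LinearMap.toContinuousLinearMap ℓ.mapMatrix with hΛ
  set c : (∀ w' : {w : {w : InfinitePlace L // IsComplex w} // ¬ w = w₀}, archLocal L N (Matrix.diagonal α) w'.1) →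
      Matrix (Fin N) (Fin N) (mixedSpace L) := fun o =>
    Matrix.of fun i j => ((0 : {w : InfinitePlace L // IsReal w} → ℝ), fun w : {w : InfinitePlace L // IsComplex w} =>
      if h : w = w₀ then (0 : ℂ) else (((o ⟨w, h⟩ : archLocal L N (Matrix.diagonal α) w) : GL (Fin N) ℂ) : Matrix (Fin N) (Fin N) ℂ) i j)
    with hc
  have hΛij : ∀ (X : Matrix (Fin N) (Fin N) ℂ) i j, Λ X i j = ((0 : {w : InfinitePlace L // IsReal w} → ℝ), Pi.single w₀ (X i j)) := by
    intro X i j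
    rw [hΛ, LinearMap.coe_toContinuousLinearMap', LinearMap.mapMatrix_apply, Matrix.map_apply, hℓ, LinearMap.comp_apply, LinearMap.inr_apply, LinearMap.coe_single]
  have hins : ∀ (X : Matrix (Fin N) (Fin N) ℂ) (o : ∀ w' : {w : {w : InfinitePlace L // IsComplex w} // ¬ w = w₀}, archLocal L N (Matrix.diagonal α) w'.1),
      (Matrix.of fun i j => ((0 : {w : InfinitePlace L // IsReal w} → ℝ), fun w : {w : InfinitePlace L // IsComplex w} =>
          if h : w = w₀ then X i j
          else (((o ⟨w, h⟩ : archLocal L N (Matrix.diagonal α) w) : GL (Fin N) ℂ) : Matrix (Fin N) (Fin N) ℂ) i j)) = Λ X + c o := by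
    intro X o; refine Matrix.ext fun i j => ?_
    rw [Matrix.add_apply, hΛij]; simp only [hc, Matrix.of_apply]; rw [Prod.mk_add_mk, add_zero]
    refine Prod.ext rfl (funext fun w => ?_); dsimp only; rw [Pi.add_apply]
    by_cases h : w = w₀
    · subst h; rw [dif_pos rfl, dif_pos rfl, Pi.single_eq_same, add_zero]
    · rw [dif_neg h, dif_neg h, Pi.single_eq_of_ne h, zero_add]
  have hfun : (fun X : Matrix (Fin N) (Fin N) ℂ =>
      ∫ o : (∀ w' : {w : {w : InfinitePlace L // IsComplex w} // ¬ w = w₀}, archLocal L N (Matrix.diagonal α) w'.1),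
        Θ (Matrix.of fun i j => ((0 : {w : InfinitePlace L // IsReal w} → ℝ), fun w : {w : InfinitePlace L // IsComplex w} =>
          if h : w = w₀ then X i j
          else (((o ⟨w, h⟩ : archLocal L N (Matrix.diagonal α) w) : GL (Fin N) ℂ) : Matrix (Fin N) (Fin N) ℂ) i j))
        ∂(Measure.pi μ)) =
      fun X => ∫ o, Θ (Λ X + c o) ∂(Measure.pi μ) := by
    funext X; exact integral_congr_ae (Filter.Eventually.of_forall fun o => by simp only [hins])
  rw [hfun]
  -- `c` is continuous
  have hcc : Continuous c := by
    rw [hc]; refine continuous_pi fun i => continuous_pi fun j => continuous_const.prodMk (continuous_pi fun w => ?_)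
    by_cases h : w = w₀
    · simp only [dif_pos h]; exact continuous_const
    · simp only [dif_neg h]
      have h2 : Continuous fun o : (∀ w' : {w : {w : InfinitePlace L // IsComplex w} // ¬ w = w₀}, archLocal L N (Matrix.diagonal α) w'.1) =>
          (((o ⟨w, h⟩ : archLocal L N (Matrix.diagonal α) w) : GL (Fin N) ℂ) : Matrix (Fin N) (Fin N) ℂ) :=
        Units.continuous_val.comp (continuous_subtype_val.comp (continuous_apply _))
      exact (continuous_apply j).comp ((continuous_apply i).comp h2)
  -- the compact set `S` carrying the `b`-support of the integrand, for every `X`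
  have hπc : ∀ w : {w : InfinitePlace L // IsComplex w}, Continuous fun M : Matrix (Fin N) (Fin N) (mixedSpace L) =>
      M.map fun x : mixedSpace L => x.2 w := fun w => continuous_id.matrix_map ((continuous_apply w).comp continuous_snd)
  have hCw : ∀ w' : {w : {w : InfinitePlace L // IsComplex w} // ¬ w = w₀}, IsCompact {k : archLocal L N (Matrix.diagonal α) w'.1 |
      ((k : GL (Fin N) ℂ) : Matrix (Fin N) (Fin N) ℂ) ∈ (fun M : Matrix (Fin N) (Fin N) (mixedSpace L) => M.map fun x : mixedSpace L => x.2 w'.1) '' tsupport Θ} :=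
    fun w' => isCompact_setOf_coe_archLocal_mem L N α w'.1 hα (hΘc.isCompact.image (hπc w'.1))
  set S : Set (∀ w' : {w : {w : InfinitePlace L // IsComplex w} // ¬ w = w₀}, archLocal L N (Matrix.diagonal α) w'.1) :=
    Set.univ.pi fun w' : {w : {w : InfinitePlace L // IsComplex w} // ¬ w = w₀} => {k : archLocal L N (Matrix.diagonal α) w'.1 |
      ((k : GL (Fin N) ℂ) : Matrix (Fin N) (Fin N) ℂ) ∈ (fun M : Matrix (Fin N) (Fin N) (mixedSpace L) => M.map fun x : mixedSpace L => x.2 w'.1) '' tsupport Θ} with hS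
  have hSc : IsCompact S := isCompact_univ_pi hCw
  -- support control: if the integrand is non-zero at `(X, o)` then `o ∈ S`
  have hsupp : ∀ X o, Θ (Λ X + c o) ≠ 0 → o ∈ S := by
    intro X o hne
    have hmem : Λ X + c o ∈ tsupport Θ := subset_tsupport _ (Function.mem_support.mpr hne)
    intro w' _
    show (((o w' : archLocal L N (Matrix.diagonal α) w'.1) : GL (Fin N) ℂ) : Matrix (Fin N) (Fin N) ℂ) ∈
      (fun M : Matrix (Fin N) (Fin N) (mixedSpace L) => M.map fun x : mixedSpace L => x.2 w'.1) '' tsupport Θ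
    refine ⟨Λ X + c o, hmem, Matrix.ext fun i j => ?_⟩
    dsimp only; rw [Matrix.map_apply, Matrix.add_apply, hΛij]; simp only [hc, Matrix.of_apply]
    rw [Prod.snd_add, Pi.add_apply]; dsimp only; rw [Pi.single_eq_of_ne w'.2, zero_add, dif_neg w'.2]
  -- differentiate under the integral sign, to all orders
  refine Literature.Analysis.Calculus.contDiff_integral_of_dominated_iteratedFDeriv (H := fun o X => Θ (Λ X + c o)) ?_ ?_ ?_
  · intro o; exact hΘ.comp (Λ.contDiff.add contDiff_const)
  · intro n X; exact (Literature.Analysis.Calculus.continuous_iteratedFDeriv_comp_affine_param hΘ Λ hcc n X).aestronglyMeasurable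
  · intro n
    have hn : (n : ℕ∞ω) ≤ ∞ := by exact_mod_cast le_top
    obtain ⟨M, hM⟩ := (hΘ.continuous_iteratedFDeriv hn).bounded_above_of_compact_support (hΘc.iteratedFDeriv n)
    -- a bound `C` uniform in `(b, X)` (`C = M·‖Λ‖ⁿ`, ★ `norm_iteratedFDeriv_comp_affine_le`)
    obtain ⟨C, hC⟩ : ∃ C : ℝ, ∀ o X, ‖iteratedFDeriv ℝ n (fun X : Matrix (Fin N) (Fin N) ℂ => Θ (Λ X + c o)) X‖ ≤ C :=
      ⟨_, fun o X => (Literature.Analysis.Calculus.norm_iteratedFDeriv_comp_affine_le hΘ Λ (c o) hn X).trans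
        (mul_le_mul_of_nonneg_right (hM _) (pow_nonneg (norm_nonneg _) _))⟩
    refine ⟨S.indicator fun _ => C, ?_, fun o X => ?_⟩
    · exact (integrableOn_const (hSc.measure_lt_top).ne).integrable_indicator hSc.isClosed.measurableSet
    · by_cases hb : o ∈ S
      · rw [Set.indicator_of_mem hb]; exact hC o X
      · rw [Set.indicator_of_notMem hb]; have h0 : (fun X : Matrix (Fin N) (Fin N) ℂ => Θ (Λ X + c o)) = fun _ => 0 :=
          funext fun X => Classical.not_not.mp fun hne => hb (hsupp X o hne)
        rw [h0, iteratedFDeriv_fun_zero, Pi.zero_apply, norm_zero]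

omit [IsCMField L] [∀ w : {w : InfinitePlace L // IsComplex w}, BorelSpace (archLocal L N (Matrix.diagonal α) w)]
  [∀ w : {w : InfinitePlace L // IsComplex w}, SecondCountableTopology (archLocal L N (Matrix.diagonal α) w)] in
open scoped Classical in
/-- **THE MIXED PARTIAL INTEGRAL HAS COMPACT SUPPORT ON `G_{w₀}`**: if `Θ(ins(↑↑x′, ·))` is not identically zero then `↑↑x′ ∈ π_{w₀}(tsupport Θ)`, a compact subset of
`M_N(ℂ)` whose preimage in `G_{w₀}` is compact (★ properness of the inclusion); no hypothesis on the measures. [cite: Rogawski1990, §8.3 p. 122] [cite: DeitmarEchterhoff2014, Lemma 9.3.3] -/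
theorem hasCompactSupport_integral_insert_comp_coe {E : Type*} [NormedAddCommGroup E] [NormedSpace ℝ E]
    (hα : ∀ i, α i ≠ 0) (w₀ : {w : InfinitePlace L // IsComplex w})
    (μ : ∀ w' : {w : {w : InfinitePlace L // IsComplex w} // ¬ w = w₀}, Measure (archLocal L N (Matrix.diagonal α) w'.1))
    (Θ : Matrix (Fin N) (Fin N) (mixedSpace L) → E) (hΘc : HasCompactSupport Θ) :
    HasCompactSupport fun x' : archLocal L N (Matrix.diagonal α) w₀ =>
      ∫ o : (∀ w' : {w : {w : InfinitePlace L // IsComplex w} // ¬ w = w₀}, archLocal L N (Matrix.diagonal α) w'.1),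
        Θ (Matrix.of fun i j => ((0 : {w : InfinitePlace L // IsReal w} → ℝ), fun w : {w : InfinitePlace L // IsComplex w} =>
          if h : w = w₀ then ((x' : GL (Fin N) ℂ) : Matrix (Fin N) (Fin N) ℂ) i j
          else (((o ⟨w, h⟩ : archLocal L N (Matrix.diagonal α) w) : GL (Fin N) ℂ) : Matrix (Fin N) (Fin N) ℂ) i j))
        ∂(Measure.pi μ) := by
  have hπc : Continuous fun M : Matrix (Fin N) (Fin N) (mixedSpace L) => M.map fun x : mixedSpace L => x.2 w₀ :=
    continuous_id.matrix_map ((continuous_apply w₀).comp continuous_snd)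
  refine HasCompactSupport.intro (isCompact_setOf_coe_archLocal_mem L N α w₀ hα (hΘc.isCompact.image hπc)) fun x' hx' => ?_
  refine integral_eq_zero_of_ae (Filter.Eventually.of_forall fun o => ?_)
  by_contra hne
  refine hx' ⟨_, subset_tsupport _ (Function.mem_support.mpr hne), Matrix.ext fun i j => ?_⟩
  dsimp only; rw [Matrix.map_apply, Matrix.of_apply]; exact dif_pos rfl

/-! ## §2 The letter form: group currency in, per-place test function out -/

open scoped Classical in
/-- **THE MIXED PARTIAL INTEGRAL OF A GLOBAL TEST FUNCTION IS A PER-PLACE TEST FUNCTION** (any Radon `μ_{w′}`): for `Θ` smooth with `g ↦ Θ ↑↑g` compactly supported ON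
`G′_∞`, there is `Θ′ : M_N(ℂ) → E`, smooth, with `k ↦ Θ′ ↑↑k` compactly supported on `G_{w₀}`, whose restriction to `G_{w₀}` is `x′ ↦ ∫ Θ ↑↑(e⁻¹(x′, o)) d(⊗ μ_{w′})(o)`
(★ cutoff `exists_contDiff_hasCompactSupport_comp_eq`, then §1, ★ `coe_archPiEquivCM_symm_assemble`). [cite: HormanderALPDO1, Thm. 1.1.9, Thm. 1.4.1]
[cite: Rogawski1990, §8.3 p. 122] [cite: DeitmarEchterhoff2014, Lemma 9.3.3] -/
theorem exists_contDiff_eq_integral_insert {E : Type*} [NormedAddCommGroup E] [NormedSpace ℝ E] [CompleteSpace E]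
    (hα : ∀ i, α i ≠ 0) (w₀ : {w : InfinitePlace L // IsComplex w})
    (μ : ∀ w' : {w : {w : InfinitePlace L // IsComplex w} // ¬ w = w₀}, Measure (archLocal L N (Matrix.diagonal α) w'.1)) [∀ w', IsFiniteMeasureOnCompacts (μ w')] [∀ w', SigmaFinite (μ w')]
    (Θ : Matrix (Fin N) (Fin N) (mixedSpace L) → E) (hΘ : ContDiff ℝ (⊤ : ℕ∞) Θ)
    (hΘc : HasCompactSupport fun g : arch (↥(maximalRealSubfield L)) L (IsCMField.complexConj L) N (Matrix.diagonal α) =>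
      Θ ((g : GL (Fin N) (mixedSpace L)) : Matrix (Fin N) (Fin N) (mixedSpace L))) :
    ∃ Θ' : Matrix (Fin N) (Fin N) ℂ → E, ContDiff ℝ (⊤ : ℕ∞) Θ' ∧
      HasCompactSupport (fun k : archLocal L N (Matrix.diagonal α) w₀ => Θ' ((k : GL (Fin N) ℂ) : Matrix (Fin N) (Fin N) ℂ)) ∧
      ∀ x' : archLocal L N (Matrix.diagonal α) w₀, Θ' ((x' : GL (Fin N) ℂ) : Matrix (Fin N) (Fin N) ℂ) =
        ∫ o : (∀ w' : {w : {w : InfinitePlace L // IsComplex w} // ¬ w = w₀}, archLocal L N (Matrix.diagonal α) w'.1),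
          Θ ((((archPiEquivCM N L (Matrix.diagonal α)).symm
            ((MeasurableEquiv.piEquivPiSubtypeProd (fun w : {w : InfinitePlace L // IsComplex w} => ↥(archLocal L N (Matrix.diagonal α) w)) (· = w₀)).symm
              ((MeasurableEquiv.piUnique fun i : {w : {w : InfinitePlace L // IsComplex w} // w = w₀} => ↥(archLocal L N (Matrix.diagonal α) i.1)).symm x', o)) :
              arch (↥(maximalRealSubfield L)) L (IsCMField.complexConj L) N (Matrix.diagonal α)) : GL (Fin N) (mixedSpace L)) : Matrix (Fin N) (Fin N) (mixedSpace L))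
          ∂(Measure.pi μ) := by
  -- cutoff: an ambient compactly supported `Θ₁` agreeing with `Θ` on the group
  have hι : Continuous fun g : arch (↥(maximalRealSubfield L)) L (IsCMField.complexConj L) N (Matrix.diagonal α) =>
      ((g : GL (Fin N) (mixedSpace L)) : Matrix (Fin N) (Fin N) (mixedSpace L)) := Units.continuous_val.comp continuous_subtype_val
  haveI : FiniteDimensional ℝ (Matrix (Fin N) (Fin N) (mixedSpace L)) := Module.Finite.matrix
  obtain ⟨Θ₁, hΘ₁, hΘ₁c, -, hΘ₁eq⟩ := Literature.Analysis.Calculus.exists_contDiff_hasCompactSupport_comp_eq hι hΘ hΘc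
  -- the smooth ambient partial orbital integral of `Θ₁`
  obtain ⟨Θ', hΘ'⟩ : ∃ Θ' : Matrix (Fin N) (Fin N) ℂ → E, Θ' = fun X : Matrix (Fin N) (Fin N) ℂ =>
      ∫ o : (∀ w' : {w : {w : InfinitePlace L // IsComplex w} // ¬ w = w₀}, archLocal L N (Matrix.diagonal α) w'.1),
        Θ₁ (Matrix.of fun i j => ((0 : {w : InfinitePlace L // IsReal w} → ℝ), fun w : {w : InfinitePlace L // IsComplex w} =>
          if h : w = w₀ then X i j
          else (((o ⟨w, h⟩ : archLocal L N (Matrix.diagonal α) w) : GL (Fin N) ℂ) : Matrix (Fin N) (Fin N) ℂ) i j))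
        ∂(Measure.pi μ) := ⟨_, rfl⟩
  have h1 : ContDiff ℝ (⊤ : ℕ∞) Θ' := by
    rw [hΘ']; exact contDiff_integral_insert L N α hα w₀ μ Θ₁ hΘ₁ hΘ₁c
  have h2 : HasCompactSupport (fun k : archLocal L N (Matrix.diagonal α) w₀ => Θ' ((k : GL (Fin N) ℂ) : Matrix (Fin N) (Fin N) ℂ)) := by
    rw [hΘ']; exact hasCompactSupport_integral_insert_comp_coe L N α hα w₀ μ Θ₁ hΘ₁c
  refine ⟨Θ', h1, h2, fun x' => ?_⟩
  rw [hΘ']; refine integral_congr_ae (Filter.Eventually.of_forall fun o => ?_)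
  have hb := coe_archPiEquivCM_symm_assemble L N α w₀ x' o
  have he := hΘ₁eq ((archPiEquivCM N L (Matrix.diagonal α)).symm
    ((MeasurableEquiv.piEquivPiSubtypeProd (fun w : {w : InfinitePlace L // IsComplex w} => ↥(archLocal L N (Matrix.diagonal α) w)) (· = w₀)).symm
      ((MeasurableEquiv.piUnique fun i : {w : {w : InfinitePlace L // IsComplex w} // w = w₀} => ↥(archLocal L N (Matrix.diagonal α) i.1)).symm x', o)))
  simp only [] at he ⊢; rw [← he, hb]

end Literature.NumberTheory.Automorphic.UnitaryGroup

end
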